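import Summits.AtomisticToContinuum.BoseEinsteinCondensation.Theorems.BECHeatBathGapIdealGasTensorisation
import Summits.AtomisticToContinuum.BoseEinsteinCondensation.Theorems.BECCutLineWeakDisorderGroundStateRigidityStubExistsNonnegGroundState
import Summits.AtomisticToContinuum.BoseEinsteinCondensation.Theorems.BECCutLineWeakDisorderGroundStateRigidityStubCompactness
import Summits.AtomisticToContinuum.BoseEinsteinCondensation.Theorems.BECHeatBathGapSquareSummableInfluenceStubGroundStateApprox
import Literature.MathematicalPhysics.QuantumManyBody.GroundState
import Literature.MathematicalPhysics.QuantumManyBody.OneParticleMarginals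
import Literature.MathematicalPhysics.QuantumManyBody.BoseGasClusterStates
import Literature.MathematicalPhysics.QuantumManyBody.BoseGasDirichletWall
import Summits.AtomisticToContinuum.BoseEinsteinCondensation.Theorems.BECInsertionCorrectorBoundaryTransferWeakFreeGroundState
import HarnessLib

/-!
# Route `BECHeatBathGap`, crux `SquareSummableInfluence` (stmt-AtomisticToContinuum-14368), line `registered`:
# the ideal-gas rung of the physics kernel `stub_groundStateInfluence`

Supports (does not close) stmt-AtomisticToContinuum-14368 (lead c1). The physics kernel of the line
(`stub_groundStateInfluence`, skeleton v2) asks, at low density and eventually in `N`, for closed-form ground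
states `Θ₀` (`N` bodies) and `Ψ₀` (`N+1` bodies) of the Dirichlet problem in the box of side
`((N+1)/ρ)^{1/3}` and bounded measurable predictors `g_i` blind to the bath particle `x_i` with total
squared influence `∑_i ∫_{Λ^{N+1}} |Ψ₀ − g_i Θ₀(tail)|² ≤ ε`. This file proves its **ideal-gas instance**
(`v = 0`, EVERY density, every `N`) — a typing check of the kernel in the tree's exact vocabulary
(`IsGroundState`, `powFun`), in the way `IdealGasTensorisation` (stmt-14374) checks the crux A1:

* `lintegral_powFun_sq_eq_one`, `lintegral_powFun_sub_powFun_sq_le` — for measurable unit modes `a, b`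
  (normalisation stated on `ℝ³`): `‖a^{⊗n}‖ = 1` and the tensor-power estimate
  `∫ |a^{⊗n} − b^{⊗n}|² ≤ n 2ⁿ ∫ |a − b|²` (telescoping at the FIRST particle, Tonelli
  `lintegral_lintegral_vecCons`; cf. the `oneFun`-phrased `4ⁿ` version
  `CoupledBaths.FreeGroundState.lintegral_powFun_sub_sq_le`, whose `measurable_powFun` is reused);
* `isGroundState_powFun_zero` — if `Ψ₁` is a one-body free Dirichlet ground state of `Λ_L` then
  `u^{⊗n}`, `u(x) = Ψ₁(x)`, IS a closed-form ground state of the free `n`-body problem: the powers of the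
  near-minimisers `φ_k → Ψ₁` (`stub_groundStateApprox`) are trial states (`powFun` machinery of
  `BoseGasCatStates` / `IdealGasTensorisation`) with energies `n 𝓔[φ_k] → n e₁ ≤ E₀(n, L)`
  (`mul_groundStateEnergy_le`) converging to `u^{⊗n}` in `L²`, so `IsGroundState.of_tendstoL2` applies;
* `groundStateInfluence_idealGas_box` — per box: `Θ₀ = u^{⊗N}`, `Ψ₀ = u^{⊗(N+1)}`,
  `g_i(Z) = u_M(Z 0)` with `u_M = u·1_{|u| ≤ M}` (bounded, blind to every bath particle); since
  `Ψ₀(Z) = u(Z 0) Θ₀(tail Z)` exactly, the influence is `N ∫_{|u|>M} |u|² → 0` as `M → ∞` (dominated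
  convergence), `≤ ε` for `M` large;
* `groundStateInfluence_idealGas` — the kernel's conclusion at `v = 0` for every `ρ > 0`, eventually in `N`.
-/

noncomputable section

open MeasureTheory Filter
open scoped ENNReal NNReal Topology

namespace Summit.AtomisticToContinuum.BoseEinsteinCondensation.Theorems.SquareSummableInfluence

open Literature.MathematicalPhysics.QuantumManyBody.BoseGas
open Summit.AtomisticToContinuum.BoseEinsteinCondensation.Theorems.GroundStateRigidity
open Summit.AtomisticToContinuum.BoseEinsteinCondensation.Theorems.IdealGasTensorisation
open Summit.AtomisticToContinuum.BoseEinsteinCondensation.CoupledBaths.FreeGroundState (measurable_powFun)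

variable {n : ℕ} {L : ℝ}

/-! ### Tensor powers of measurable unit modes -/

/-- `‖a^{⊗n}‖² = 1` for a measurable unit mode `a` (Tonelli at the first particle). [folklore] -/
theorem lintegral_powFun_sq_eq_one {a : Space → ℂ} (ha : Measurable a)
    (ha1 : ∫⁻ x, (‖a x‖₊ : ℝ≥0∞) ^ 2 = 1) :
    ∀ n, ∫⁻ X, (‖powFun a n X‖₊ : ℝ≥0∞) ^ 2 = 1
  | 0 => by
      simp only [powFun_zero, nnnorm_one, ENNReal.coe_one, one_pow, lintegral_const, one_mul]
      simp [volume_pi]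
  | n + 1 => by
      have hF : Measurable fun X : Config (n + 1) => (‖powFun a (n + 1) X‖₊ : ℝ≥0∞) ^ 2 :=
        (measurable_powFun ha (n + 1)).nnnorm.coe_nnreal_ennreal.pow_const 2
      have hG : Measurable fun Y : Config n => (‖powFun a n Y‖₊ : ℝ≥0∞) ^ 2 :=
        (measurable_powFun ha n).nnnorm.coe_nnreal_ennreal.pow_const 2
      rw [← lintegral_lintegral_vecCons hF]
      simp only [powFun_vecCons, nnnorm_mul, ENNReal.coe_mul, mul_pow]
      have h1 : ∀ x : Space, ∫⁻ Y, (‖a x‖₊ : ℝ≥0∞) ^ 2 * (‖powFun a n Y‖₊ : ℝ≥0∞) ^ 2 =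
          (‖a x‖₊ : ℝ≥0∞) ^ 2 := fun x => by
        rw [lintegral_const_mul _ hG, lintegral_powFun_sq_eq_one ha ha1 n, mul_one]
      simp only [h1, ha1]

/-- **Tensor-power estimate**: for measurable unit modes `a, b`,
`∫ |a^{⊗n} − b^{⊗n}|² ≤ n 2ⁿ ∫ |a − b|²` (at the first particle
`a(x)A(Y) − b(x)B(Y) = (a − b)(x) A(Y) + b(x)(A − B)(Y)`, `|s+t|² ≤ 2|s|² + 2|t|²`, Tonelli, induction).
[folklore] -/
theorem lintegral_powFun_sub_powFun_sq_le {a b : Space → ℂ} (ha : Measurable a) (hb : Measurable b)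
    (ha1 : ∫⁻ x, (‖a x‖₊ : ℝ≥0∞) ^ 2 = 1) (hb1 : ∫⁻ x, (‖b x‖₊ : ℝ≥0∞) ^ 2 = 1) :
    ∀ n : ℕ, ∫⁻ X, (‖powFun a n X - powFun b n X‖₊ : ℝ≥0∞) ^ 2 ≤
      ((n : ℝ≥0∞) * 2 ^ n) * ∫⁻ x, (‖a x - b x‖₊ : ℝ≥0∞) ^ 2
  | 0 => by simp [powFun_zero]
  | n + 1 => by
      have ih := lintegral_powFun_sub_powFun_sq_le ha hb ha1 hb1 n
      set d : ℝ≥0∞ := ∫⁻ x, (‖a x - b x‖₊ : ℝ≥0∞) ^ 2 with hd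
      have hF : Measurable fun X : Config (n + 1) =>
          (‖powFun a (n + 1) X - powFun b (n + 1) X‖₊ : ℝ≥0∞) ^ 2 :=
        ((measurable_powFun ha _).sub (measurable_powFun hb _)).nnnorm.coe_nnreal_ennreal.pow_const 2
      have hA : Measurable fun Y : Config n => (‖powFun a n Y‖₊ : ℝ≥0∞) ^ 2 :=
        (measurable_powFun ha n).nnnorm.coe_nnreal_ennreal.pow_const 2
      have hAB : Measurable fun Y : Config n => (‖powFun a n Y - powFun b n Y‖₊ : ℝ≥0∞) ^ 2 :=
        ((measurable_powFun ha n).sub (measurable_powFun hb n)).nnnorm.coe_nnreal_ennreal.pow_const 2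
      have hm1 : Measurable fun Y : Config n => 2 * (‖powFun a n Y‖₊ : ℝ≥0∞) ^ 2 := hA.const_mul 2
      have hx1 : Measurable fun x : Space => (‖a x - b x‖₊ : ℝ≥0∞) ^ 2 :=
        (ha.sub hb).nnnorm.coe_nnreal_ennreal.pow_const 2
      have hx2 : Measurable fun x : Space => (‖b x‖₊ : ℝ≥0∞) ^ 2 :=
        hb.nnnorm.coe_nnreal_ennreal.pow_const 2
      have hx3 : Measurable fun x : Space => 2 * (‖a x - b x‖₊ : ℝ≥0∞) ^ 2 := hx1.const_mul 2
      -- pointwise at the first particle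
      have hpt : ∀ (x : Space) (Y : Config n),
          (‖powFun a (n + 1) (Matrix.vecCons x Y) - powFun b (n + 1) (Matrix.vecCons x Y)‖₊ : ℝ≥0∞) ^ 2 ≤
            2 * (‖a x - b x‖₊ : ℝ≥0∞) ^ 2 * (‖powFun a n Y‖₊ : ℝ≥0∞) ^ 2 +
              (‖b x‖₊ : ℝ≥0∞) ^ 2 * (2 * (‖powFun a n Y - powFun b n Y‖₊ : ℝ≥0∞) ^ 2) := by
        intro x Y
        rw [powFun_vecCons, powFun_vecCons]
        have h := coe_nnnorm_add_sq_le ((a x - b x) * powFun a n Y) (b x * (powFun a n Y - powFun b n Y))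
        rw [show (a x - b x) * powFun a n Y + b x * (powFun a n Y - powFun b n Y) =
            a x * powFun a n Y - b x * powFun b n Y by ring] at h
        refine h.trans (le_of_eq ?_)
        rw [nnnorm_mul, nnnorm_mul, ENNReal.coe_mul, ENNReal.coe_mul, mul_pow, mul_pow]
        ring
      calc ∫⁻ X, (‖powFun a (n + 1) X - powFun b (n + 1) X‖₊ : ℝ≥0∞) ^ 2
          = ∫⁻ x, ∫⁻ Y, (‖powFun a (n + 1) (Matrix.vecCons x Y) -
              powFun b (n + 1) (Matrix.vecCons x Y)‖₊ : ℝ≥0∞) ^ 2 := (lintegral_lintegral_vecCons hF).symm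
        _ ≤ ∫⁻ x, ∫⁻ Y, (2 * (‖a x - b x‖₊ : ℝ≥0∞) ^ 2 * (‖powFun a n Y‖₊ : ℝ≥0∞) ^ 2 +
              (‖b x‖₊ : ℝ≥0∞) ^ 2 * (2 * (‖powFun a n Y - powFun b n Y‖₊ : ℝ≥0∞) ^ 2)) :=
            lintegral_mono fun x => lintegral_mono fun Y => hpt x Y
        _ = ∫⁻ x, (2 * (‖a x - b x‖₊ : ℝ≥0∞) ^ 2 +
              (‖b x‖₊ : ℝ≥0∞) ^ 2 * (2 * ∫⁻ Y, (‖powFun a n Y - powFun b n Y‖₊ : ℝ≥0∞) ^ 2)) := by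
            refine lintegral_congr fun x => ?_
            rw [lintegral_add_left (hA.const_mul _), lintegral_const_mul _ hA,
              lintegral_powFun_sq_eq_one ha ha1 n, mul_one, lintegral_const_mul _ (hAB.const_mul 2),
              lintegral_const_mul _ hAB]
        _ = 2 * d + 1 * (2 * ∫⁻ Y, (‖powFun a n Y - powFun b n Y‖₊ : ℝ≥0∞) ^ 2) := by
            rw [lintegral_add_left hx3, lintegral_const_mul _ hx1, lintegral_mul_const _ hx2, hb1]
        _ ≤ 2 * d + 1 * (2 * (((n : ℝ≥0∞) * 2 ^ n) * d)) := by gcongr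
        _ = (2 + (n : ℝ≥0∞) * 2 ^ (n + 1)) * d := by ring
        _ ≤ (((n + 1 : ℕ) : ℝ≥0∞) * 2 ^ (n + 1)) * d := by
            gcongr
            have h2 : (2 : ℝ≥0∞) ≤ 2 ^ (n + 1) := by
              calc (2 : ℝ≥0∞) = 2 ^ 1 := (pow_one _).symm
                _ ≤ 2 ^ (n + 1) := pow_le_pow_right₀ (by norm_num) (by omega)
            calc 2 + (n : ℝ≥0∞) * 2 ^ (n + 1) ≤ 2 ^ (n + 1) + (n : ℝ≥0∞) * 2 ^ (n + 1) :=
                  add_le_add h2 le_rfl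
              _ = (((n + 1 : ℕ)) : ℝ≥0∞) * 2 ^ (n + 1) := by push_cast; ring

/-! ### Powers of a one-body free ground state are free ground states -/

/-- The one-body mode `x ↦ Ψ₁(x)` of a one-body ground state, as a function on `ℝ³`, is measurable,
normalised and vanishes off the box. [folklore] -/
theorem mode_of_groundState {Ψ₁ : Config 1 → ℂ} (h₁ : IsGroundState 0 L Ψ₁) :
    Measurable (fun x : Space => Ψ₁ fun _ => x) ∧
      (∫⁻ x, (‖Ψ₁ fun _ => x‖₊ : ℝ≥0∞) ^ 2 = 1) ∧
      ∀ x : Space, x ∉ box L → Ψ₁ (fun _ => x) = 0 := by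
  refine ⟨h₁.measurable.comp (measurable_pi_lambda _ fun _ => measurable_id), ?_, fun x hx => ?_⟩
  · rw [← lintegral_funUnique_comp (fun x => (‖Ψ₁ fun _ => x‖₊ : ℝ≥0∞) ^ 2)]
    simp only [const_apply_zero_eq]
    exact h₁.norm_eq
  · exact h₁.eq_zero _ fun h => hx (h 0)

/-- **Powers of a one-body free ground state are free ground states.** If `Ψ₁` is a closed-form
ground state of ONE free particle in `Λ_L` then for every `n` the tensor power
`u^{⊗n}`, `u(x) = Ψ₁(x)`, is a closed-form ground state of the free `n`-body Dirichlet problem in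
`Λ_L`: the powers `φ_k^{⊗n}` of one-body near-minimisers `φ_k → Ψ₁` are admissible trial states with
energies `n 𝓔[φ_k] → n e₁ ≤ E₀(n, L)` converging to `u^{⊗n}` in `L²`. [folklore] -/
theorem isGroundState_powFun_zero {Ψ₁ : Config 1 → ℂ} (h₁ : IsGroundState 0 L Ψ₁) (n : ℕ) :
    IsGroundState 0 L (powFun (fun x : Space => Ψ₁ fun _ => x) n) := by
  obtain ⟨hu, hu1, hu0⟩ := mode_of_groundState h₁
  set u : Space → ℂ := fun x => Ψ₁ fun _ => x with hudef
  have hE1 : groundStateEnergy 0 1 L ≠ ⊤ := h₁.groundStateEnergy_ne_top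
  -- one-body near-minimisers `φ_k` with `𝓔[φ_k] ≤ e₁ + 1/(k+1)` and `∫|φ_k − Ψ₁|² ≤ 1/(k+1)`
  have hk : ∀ k : ℕ, (0 : ℝ≥0∞) < ((k : ℝ≥0∞) + 1)⁻¹ := fun k =>
    ENNReal.inv_pos.2 (ENNReal.add_ne_top.2 ⟨ENNReal.natCast_ne_top k, ENNReal.one_ne_top⟩)
  have hk' : ∀ k : ℕ, (0 : ℝ) < 1 / ((k : ℝ) + 1) := fun k => by positivity
  choose φ hφe hφd using fun k : ℕ =>
    stub_groundStateApprox 1 L 0 Ψ₁ h₁ _ (hk k) _ (hk' k)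
  -- their tensor powers as trial states
  let Φ : ℕ → TrialState n L := fun k =>
    { ψ := powFun (fun x => (φ k).ψ fun _ => x) n
      contDiff := contDiff_powFun (contDiff_oneFun_mode (φ k)) n
      eq_zero := fun X hX => powFun_mode_eq_zero (φ k) hX
      symm := fun σ X => powFun_comp_perm _ σ X
      norm_eq := lintegral_powFun_sq (contDiff_oneFun_mode (φ k)) (lintegral_oneFun_mode_sq (φ k)) n }
  have hΦE : ∀ k, energy 0 (Φ k) = n * energy 0 (φ k) := fun k => by
    rw [energy_eq_rawEnergy, energy_eq_rawEnergy,
      show (Φ k).ψ = powFun (fun x => (φ k).ψ fun _ => x) n from rfl,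
      rawEnergy_zero_powFun (contDiff_oneFun_mode (φ k)) (lintegral_oneFun_mode_sq (φ k)) n, oneFun_mode]
  have hlow : (n : ℝ≥0∞) * groundStateEnergy 0 1 L ≤ groundStateEnergy 0 n L := by
    have h := mul_groundStateEnergy_le (v := 0) measurable_const L 1 n 0
    simpa using h
  -- finite energy of the `n`-body problem
  have hE : groundStateEnergy 0 n L ≠ ⊤ := by
    refine ne_top_of_le_ne_top ?_ (groundStateEnergy_le_energy 0 (Φ 0))
    rw [hΦE 0]
    refine ENNReal.mul_ne_top (ENNReal.natCast_ne_top n) (ne_top_of_le_ne_top ?_ (hφe 0))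
    exact ENNReal.add_ne_top.2 ⟨hE1, ENNReal.inv_ne_top.2 (by positivity)⟩
  -- `liminf` of the energies is `≤ n e₁ ≤ E₀(n, L)`
  have hup : Tendsto (fun k : ℕ => (n : ℝ≥0∞) * (groundStateEnergy 0 1 L + ((k : ℝ≥0∞) + 1)⁻¹))
      atTop (𝓝 ((n : ℝ≥0∞) * groundStateEnergy 0 1 L)) := by
    have h0 : Tendsto (fun k : ℕ => ((k : ℝ≥0∞) + 1)⁻¹) atTop (𝓝 0) := by
      have h := ENNReal.tendsto_inv_nat_nhds_zero.comp (tendsto_add_atTop_nat 1)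
      refine h.congr fun k => ?_
      simp
    have h1 := (tendsto_const_nhds (x := groundStateEnergy 0 1 L)).add h0
    rw [add_zero] at h1
    exact ENNReal.Tendsto.const_mul h1 (Or.inr (ENNReal.natCast_ne_top n))
  have hlim : liminf (fun k => energy 0 (Φ k)) atTop ≤ groundStateEnergy 0 n L := by
    refine (liminf_le_liminf (Eventually.of_forall fun k => ?_)).trans (hup.liminf_eq.le.trans hlow)
    rw [hΦE k]
    gcongr
    exact hφe k
  -- `Φ_k → u^{⊗n}` in `L²`
  have hT : TendstoL2 Φ (powFun u n) := by
    have hub : ∀ k, ∫⁻ X, (‖(Φ k).ψ X - powFun u n X‖₊ : ℝ≥0∞) ^ 2 ≤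
        ((n : ℝ≥0∞) * 2 ^ n) * ENNReal.ofReal (1 / ((k : ℝ) + 1)) := fun k => by
      have hmk : Measurable fun x : Space => (φ k).ψ fun _ => x :=
        (φ k).contDiff.continuous.measurable.comp (measurable_pi_lambda _ fun _ => measurable_id)
      refine (lintegral_powFun_sub_powFun_sq_le hmk hu (lintegral_mode_sq (φ k)) hu1 n).trans ?_
      gcongr
      rw [← lintegral_funUnique_comp (fun x => (‖((φ k).ψ fun _ => x) - Ψ₁ fun _ => x‖₊ : ℝ≥0∞) ^ 2)]
      simp only [const_apply_zero_eq]
      exact hφd k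
    have h0 : Tendsto (fun k : ℕ => ((n : ℝ≥0∞) * 2 ^ n) * ENNReal.ofReal (1 / ((k : ℝ) + 1)))
        atTop (𝓝 0) := by
      have h := ENNReal.tendsto_ofReal (tendsto_one_div_add_atTop_nhds_zero_nat)
      rw [ENNReal.ofReal_zero] at h
      have hc : (n : ℝ≥0∞) * 2 ^ n ≠ ⊤ :=
        ENNReal.mul_ne_top (ENNReal.natCast_ne_top n) (ENNReal.pow_ne_top (by norm_num : (2 : ℝ≥0∞) ≠ ⊤))
      have h' := ENNReal.Tendsto.const_mul (a := (n : ℝ≥0∞) * 2 ^ n) h (Or.inr hc)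
      rwa [mul_zero] at h'
    exact tendsto_of_tendsto_of_tendsto_of_le_of_le tendsto_const_nhds h0 (fun _ => zero_le) hub
  exact IsGroundState.of_tendstoL2 (measurable_powFun hu n)
    (fun X hX => powFun_eq_zero_of_exists u (by
      simp only [boxN, Set.mem_setOf_eq, not_forall] at hX
      obtain ⟨i, hi⟩ := hX
      exact ⟨i, hu0 (X i) hi⟩))
    (fun σ X => powFun_comp_perm u σ X) hE hT hlim

/-! ### The ideal-gas instance of the physics kernel -/

/-- **Ideal-gas instance of `stub_groundStateInfluence`, per box.** For `L > 0`, every `N` and `ε > 0`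
there are free Dirichlet ground states `Θ₀ = u^{⊗N}`, `Ψ₀ = u^{⊗(N+1)}` of `Λ_L` (`u` the mode of a
one-body free ground state) and bounded measurable predictors `g_i(Z) = u_M(Z 0)`,
`u_M = u·1_{|u| ≤ M}`, blind to every bath particle, with
`∑_i ∫_{Λ^{N+1}} |Ψ₀ − g_i Θ₀(tail)|² ≤ N ∫_{|u| > M} |u|² ≤ ε` (dominated convergence in `M`). [folklore] -/
theorem groundStateInfluence_idealGas_box (hL : 0 < L) (N : ℕ) (ε : ℝ) (hε : 0 < ε) :
    ∃ (Θ₀ : Config N → ℂ) (Ψ₀ : Config (N + 1) → ℂ),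
      IsGroundState 0 L Θ₀ ∧ IsGroundState 0 L Ψ₀ ∧
      ∃ g : Fin N → Config (N + 1) → ℂ,
        (∀ i, Measurable (g i)) ∧ (∃ M : ℝ, ∀ i Z, ‖g i Z‖ ≤ M) ∧
        (∀ i Z x, g i (Function.update Z (Fin.succ i) x) = g i Z) ∧
        (∑ i : Fin N, ∫⁻ Z in boxN (N + 1) L,
            (‖Ψ₀ Z - g i Z * Θ₀ (Matrix.vecTail Z)‖₊ : ℝ≥0∞) ^ 2) ≤ ENNReal.ofReal ε := by
  -- a one-body free ground state and its mode `u`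
  have hE1 : groundStateEnergy 0 1 L ≠ ⊤ := (groundStateEnergy_one_lt_top 0 hL).ne
  obtain ⟨Ψ₁r, -, h₁⟩ := stub_existsNonnegGroundState stub_compactness 1 0 L hE1
  set Ψ₁ : Config 1 → ℂ := fun Y => (Ψ₁r Y : ℂ) with hΨ₁
  obtain ⟨hu, hu1, -⟩ := mode_of_groundState h₁
  set u : Space → ℂ := fun x => Ψ₁ fun _ => x with hudef
  -- the tail `M ↦ ∫_{|u| > M} |u|²` tends to `0`
  set T : ℕ → ℝ≥0∞ := fun m => ∫⁻ x, {x : Space | (m : ℝ) < ‖u x‖}.indicator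
    (fun x => (‖u x‖₊ : ℝ≥0∞) ^ 2) x with hT
  have husq : Measurable fun x : Space => (‖u x‖₊ : ℝ≥0∞) ^ 2 := hu.nnnorm.coe_nnreal_ennreal.pow_const 2
  have hSm : ∀ m : ℕ, MeasurableSet {x : Space | (m : ℝ) < ‖u x‖} := fun m =>
    measurableSet_lt measurable_const hu.norm
  have hT0 : Tendsto T atTop (𝓝 0) := by
    have h := tendsto_lintegral_of_dominated_convergence (μ := (volume : Measure Space))
      (F := fun (m : ℕ) (x : Space) => {x : Space | (m : ℝ) < ‖u x‖}.indicator
        (fun x => (‖u x‖₊ : ℝ≥0∞) ^ 2) x)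
      (f := fun _ => 0) (fun x => (‖u x‖₊ : ℝ≥0∞) ^ 2) (fun m => husq.indicator (hSm m))
      (fun m => Eventually.of_forall fun x => Set.indicator_le_self _ _ x) (by rw [hu1]; exact ENNReal.one_ne_top)
      (Eventually.of_forall fun x => by
        refine tendsto_atTop_of_eventually_const (i₀ := Nat.ceil ‖u x‖) fun m hm => ?_
        rw [Set.indicator_of_notMem]
        simp only [Set.mem_setOf_eq, not_lt]
        exact (Nat.le_ceil _).trans (by exact_mod_cast hm))
    simpa [lintegral_zero] using h
  -- choose `M` with `N · T M ≤ ε`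
  have hNT : Tendsto (fun m => (N : ℝ≥0∞) * T m) atTop (𝓝 0) := by
    have h := ENNReal.Tendsto.const_mul hT0 (Or.inr (ENNReal.natCast_ne_top N))
    rwa [mul_zero] at h
  have hεpos : (0 : ℝ≥0∞) < ENNReal.ofReal ε := ENNReal.ofReal_pos.2 hε
  obtain ⟨M, hM⟩ := ((tendsto_order.1 hNT).2 _ hεpos).exists
  -- the truncated mode and the predictors
  set uM : Space → ℂ := fun x => if ‖u x‖ ≤ (M : ℝ) then u x else 0 with huM
  have huMm : Measurable uM := Measurable.ite (measurableSet_le hu.norm measurable_const) hu measurable_const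
  have huMb : ∀ x, ‖uM x‖ ≤ (M : ℝ) := fun x => by
    by_cases h : ‖u x‖ ≤ (M : ℝ)
    · simp only [huM, if_pos h]; exact h
    · simp only [huM, if_neg h, norm_zero]; positivity
  have hdiff : ∀ x, (‖u x - uM x‖₊ : ℝ≥0∞) ^ 2 =
      {x : Space | (M : ℝ) < ‖u x‖}.indicator (fun x => (‖u x‖₊ : ℝ≥0∞) ^ 2) x := fun x => by
    by_cases h : ‖u x‖ ≤ (M : ℝ)
    · rw [Set.indicator_of_notMem (by simpa using h)]
      simp [huM, if_pos h]
    · rw [Set.indicator_of_mem (by simpa using h)]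
      simp [huM, if_neg h]
  refine ⟨powFun u N, powFun u (N + 1), isGroundState_powFun_zero h₁ N,
    isGroundState_powFun_zero h₁ (N + 1), fun _ Z => uM (Z 0),
    fun _ => huMm.comp (measurable_pi_apply 0), ⟨M, fun _ Z => huMb (Z 0)⟩, fun i Z x => ?_, ?_⟩
  · show uM (Function.update Z (Fin.succ i) x 0) = uM (Z 0)
    rw [Function.update_of_ne (Fin.succ_ne_zero i).symm]
  · -- each term equals `T M`; `N` terms
    have hterm : ∀ i : Fin N, ∫⁻ Z in boxN (N + 1) L,
        (‖powFun u (N + 1) Z - uM (Z 0) * powFun u N (Matrix.vecTail Z)‖₊ : ℝ≥0∞) ^ 2 ≤ T M := by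
      intro i
      have hF : Measurable fun Z : Config (N + 1) =>
          (‖powFun u (N + 1) Z - uM (Z 0) * powFun u N (Matrix.vecTail Z)‖₊ : ℝ≥0∞) ^ 2 :=
        ((measurable_powFun hu _).sub ((huMm.comp (measurable_pi_apply 0)).mul
          ((measurable_powFun hu N).comp measurable_vecTail))).nnnorm.coe_nnreal_ennreal.pow_const 2
      have hA : Measurable fun Y : Config N => (‖powFun u N Y‖₊ : ℝ≥0∞) ^ 2 :=
        (measurable_powFun hu N).nnnorm.coe_nnreal_ennreal.pow_const 2
      calc ∫⁻ Z in boxN (N + 1) L,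
            (‖powFun u (N + 1) Z - uM (Z 0) * powFun u N (Matrix.vecTail Z)‖₊ : ℝ≥0∞) ^ 2
          ≤ ∫⁻ Z, (‖powFun u (N + 1) Z - uM (Z 0) * powFun u N (Matrix.vecTail Z)‖₊ : ℝ≥0∞) ^ 2 :=
            setLIntegral_le_lintegral _ _
        _ = ∫⁻ x, ∫⁻ Y, (‖powFun u (N + 1) (Matrix.vecCons x Y) -
              uM (Matrix.vecCons x Y 0) * powFun u N (Matrix.vecTail (Matrix.vecCons x Y))‖₊ : ℝ≥0∞) ^ 2 :=
            (lintegral_lintegral_vecCons hF).symm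
        _ = ∫⁻ x, ∫⁻ Y, (‖u x - uM x‖₊ : ℝ≥0∞) ^ 2 * (‖powFun u N Y‖₊ : ℝ≥0∞) ^ 2 := by
            refine lintegral_congr fun x => lintegral_congr fun Y => ?_
            rw [powFun_vecCons, Matrix.cons_val_zero, Matrix.tail_cons, ← sub_mul, nnnorm_mul,
              ENNReal.coe_mul, mul_pow]
        _ = ∫⁻ x, (‖u x - uM x‖₊ : ℝ≥0∞) ^ 2 := by
            refine lintegral_congr fun x => ?_
            rw [lintegral_const_mul _ hA, lintegral_powFun_sq_eq_one hu hu1 N, mul_one]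
        _ = T M := lintegral_congr fun x => hdiff x
    calc (∑ i : Fin N, ∫⁻ Z in boxN (N + 1) L,
          (‖powFun u (N + 1) Z - uM (Z 0) * powFun u N (Matrix.vecTail Z)‖₊ : ℝ≥0∞) ^ 2)
        ≤ ∑ _i : Fin N, T M := Finset.sum_le_sum fun i _ => hterm i
      _ = (N : ℝ≥0∞) * T M := by simp
      _ ≤ ENNReal.ofReal ε := hM.le

/-- **The physics kernel of line `registered` holds for the ideal gas, at every density.** At
`v = 0`, for every `ε > 0`, every `ρ > 0` and every `N`: the free Dirichlet ground states
`Θ₀ = u^{⊗N}`, `Ψ₀ = u^{⊗(N+1)}` of the box of side `((N+1)/ρ)^{1/3}` and the predictors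
`g_i(Z) = u_M(Z 0)` have total squared influence `≤ ε` (`groundStateInfluence_idealGas_box`) — the
`v = 0` instance of the registered stub `stub_groundStateInfluence` (a typing check: the kernel is
exactly satisfiable, with influence `N ∫_{|u|>M}|u|² → 0`, where the gas is a product state). [folklore] -/
theorem groundStateInfluence_idealGas :
    ∀ ε : ℝ, 0 < ε → ∀ ρ : ℝ, 0 < ρ → ∀ᶠ N : ℕ in atTop,
      ∃ (Θ₀ : Config N → ℂ) (Ψ₀ : Config (N + 1) → ℂ),
        IsGroundState 0 (sideLength ρ (N + 1)) Θ₀ ∧ IsGroundState 0 (sideLength ρ (N + 1)) Ψ₀ ∧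
        ∃ g : Fin N → Config (N + 1) → ℂ,
          (∀ i, Measurable (g i)) ∧ (∃ M : ℝ, ∀ i Z, ‖g i Z‖ ≤ M) ∧
          (∀ i Z x, g i (Function.update Z (Fin.succ i) x) = g i Z) ∧
          (∑ i : Fin N, ∫⁻ Z in boxN (N + 1) (sideLength ρ (N + 1)),
              (‖Ψ₀ Z - g i Z * Θ₀ (Matrix.vecTail Z)‖₊ : ℝ≥0∞) ^ 2) ≤ ENNReal.ofReal ε := by
  intro ε hε ρ hρ
  exact Eventually.of_forall fun N =>
    groundStateInfluence_idealGas_box (sideLength_pos_of_pos hρ (Nat.succ_pos N)) N ε hε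

end Summit.AtomisticToContinuum.BoseEinsteinCondensation.Theorems.SquareSummableInfluence

end
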